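import Literature.MathematicalPhysics.KineticTheory.HardSphereCanonicalTorus
import Mathlib.Analysis.Normed.Group.Tannery
import Mathlib.Analysis.SpecificLimits.Normed

/-!
# The canonical hard-sphere gas on `𝕋³` at low density: convergence of the insertion ratios

Topic `Literature/MathematicalPhysics/KineticTheory` (fourth file towards the named fact
`Literature.MathematicalPhysics.KineticTheory.localGibbs_densityLLN` of `HardSphereEulerProofs`,
after `Probability/LatticeModels/HardCoreUrsell`, `StatisticalMechanics/HardCoreCanonical` and
`KineticTheory/HardSphereCanonicalTorus`; the law of large numbers itself is assembled in
`HardSphereEulerLLN`).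

Along the hydrodynamic scaling of `HardSphereEuler` — `N + 1` labelled points of `𝕋³` with common
law `μ = β(y) dy` (`β` a `DensityProfile`), hard core at minimal-image distance
`ε_N = σ (N+1)^{-1/3}` (`hsDiameter`) — write `Ξ_N(m)` for the hard-core probability of the first
`m` labels (`XiN`), `q_N(m) = Ξ_N(m)/Ξ_N(m+1) ≥ 1` for the inverse insertion probability of one
more particle (`qN`), `r_N(m, j) = Ξ_N(m-j)/Ξ_N(m)` (`rN`), and `λ = M v₁ σ³`
(`ovDensity`; `(N+1) p_{ε_N} = λ`, `pOv_hsDiameter`). This file proves that the insertion ratios have a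
thermodynamic limit: **for every fixed `l`, `q_N(N - l) → R(σ)` as `N → ∞`** (`tendsto_qN_sub`),
hence `r_N(N+1-s, j) → R(σ)ʲ` (`tendsto_rN`), where `R = R(σ) ∈ [1/2, 2]` (`ratioLimit`) solves
the limit form `R · F(R) = 1`, `F(R) = ∑_j γ_j (∫ β^{j+1}) Rʲ` (`ratioSeries`), of the recursion
`Ξ(m+1) = ∑_{j ≤ m} C(m, j) w(j+1) Ξ(m-j)` of `HardSphereCanonicalTorus` (`Xi_eq_sum`).

* Uniform bounds (`XiN_pos`, `one_le_qN`, `qN_le`, `rN_le`; `abs_coefN_le`): by the insertion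
  bound `Ξ_N(m+1) ≥ Ξ_N(m)(1 - λ)`, all partition functions are positive and
  `1 ≤ q_N(m) ≤ (1-λ)⁻¹`; by the tree bound and `C(m, j) ≤ mʲ/j!`, the coefficients
  `C(m, j) W^g_N(j+1)` (`coefN`) are bounded by `C e (eλ)ʲ`, uniformly in `N` and `m ≤ N + 1`
  (`treeNumber_succ_mul_pow_div_factorial_le`: `t(k+1) yᵏ/k! ≤ e (ey)ᵏ`, from the tree-sum
  bound of `HardCoreUrsell` at `y = 1/e`).
* Limits of the coefficients (`tendsto_coefN`, `abs_coefLim_le`): the cluster limit of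
  `HardSphereCanonicalTorus`, `C(N-s, j) W^g_N(j+1) → γ_j ∫ g β^{j+1}` (`coefLim`).
* The limit ratio (`exists_ratio`, `ratioLimit_spec`): `F` is a power series with majorant
  `e ∑ θʲ`, `θ = 2eλ` (`geomRatio`), continuous on `[0, 2]` with `|F - 1| ≤ eθ/(1-θ)`, so
  `R F(R) = 1` has a root in `[1/2, 2]` by the intermediate value theorem once `eθ/(1-θ) < 1/2`.
* **Convergence** (`tendsto_qN_sub`), a two-scale contraction argument: dividing the recursion
  by `Ξ_N(m)` gives `1/q_N(m) = ∑_{j ≤ m} C(m,j) W¹_N(j+1) r_N(m,j)` (`inv_qN_eq_sum`) with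
  `r_N(m, j)` a product of `j` ratios `q_N(m-1-i)`; comparing with `1/R = F(R)` term by term up to
  order `J` and bounding both tails geometrically (`abs_inv_qN_sub_inv_le`) shows that an eventual
  (in `N`, for every fixed shift `l`) error bound `η` on `|q_N(N-l) - R|` improves to
  `4(κ η + (J+1) 2ᴶ τ + 2 e θ^{J+1}/(1-θ))`, `κ = eθ/(1-θ)²` (`eventually_abs_qN_sub_le_step`);
  iterating, the error tends to `0` when `4κ < 1`.

All smallness conditions (`0 < σ < 1/2`, `λ ≤ 1/2`, `θ < 1`, `eθ/(1-θ) < 1/2`, `4κ < 1`;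
`contractionC`, `geomTail`) hold for `σ` small, `σ < σ₀(β)`; they are bundled in the hypothesis
structure `SmallDensity P σ` — the convergence theorems live in its namespace, for dot notation —
and discharged in `HardSphereEulerLLN`. This elementary positivity/contraction route replaces,
for the canonical hard-core gas at low density, the abstract polymer (Kotecký–Preiss) expansion
of Pulvirenti–Tsagkarogiannis (2012), §3 and Thm. 3.1, whose thermodynamic limit (Thm. 2.1 and
§5 there: the canonical free energy with periodic boundary conditions and its finite-volume
corrections, for a homogeneous gas) is what the convergence of the insertion ratios expresses
for the one-body-inhomogeneous periodic hard-sphere gas considered here.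

## References

* E. Pulvirenti, D. Tsagkarogiannis, *Cluster expansion in the canonical ensemble*, Comm. Math.
  Phys. 316 (2012) 289–306 (arXiv:1105.1022), Thm. 2.1, §3 (Thm. 3.1), §4, §5.
  [PulvirentiTsagkarogiannis2012]
* H. Spohn, *Large Scale Dynamics of Interacting Particles*, Springer 1991, Part I §2.2–2.3
  (one-phase region at low density; local equilibrium). [Spohn1991]
-/

namespace Literature.MathematicalPhysics.KineticTheory

open MeasureTheory ProbabilityTheory Finset Filter Topology Literature.Probability.LatticeModels StatisticalMechanics
open scoped ENNReal

noncomputable section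

/-! ### Geometric form of the tree bounds -/

/-- `t(k+1)/k! ≤ e^{k+1}` (from the tree-sum bound at `y = 1/e`). [folklore] -/
theorem treeNumber_succ_div_factorial_le (k : ℕ) :
    (treeNumber (k + 1) : ℝ) / k.factorial ≤ Real.exp 1 ^ (k + 1) := by
  have he : 0 < Real.exp 1 := Real.exp_pos 1
  have hy : (0 : ℝ) ≤ (Real.exp 1)⁻¹ := by positivity
  have hy' : Real.exp 1 * (Real.exp 1)⁻¹ ≤ 1 := by rw [mul_inv_cancel₀ he.ne']
  have hsum := sum_range_treeNumber_mul_pow_div_factorial_le hy hy' (k + 1)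
  have hterm : (treeNumber (k + 1) : ℝ) * (Real.exp 1)⁻¹ ^ k / k.factorial ≤ Real.exp 1 := by
    refine le_trans ?_ hsum
    refine single_le_sum (f := fun i => (treeNumber (i + 1) : ℝ) * (Real.exp 1)⁻¹ ^ i / i.factorial)
      (fun i _ => by positivity) (self_mem_range_succ k)
  have hek : 0 < Real.exp 1 ^ k := pow_pos he k
  have key : (treeNumber (k + 1) : ℝ) / k.factorial =
      ((treeNumber (k + 1) : ℝ) * (Real.exp 1)⁻¹ ^ k / k.factorial) * Real.exp 1 ^ k := by
    rw [inv_pow]; field_simp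
  rw [key, pow_succ']
  exact mul_le_mul_of_nonneg_right hterm hek.le

/-- `t(k+1) yᵏ/k! ≤ e (e y)ᵏ` for `y ≥ 0`. [folklore] -/
theorem treeNumber_succ_mul_pow_div_factorial_le {y : ℝ} (hy : 0 ≤ y) (k : ℕ) :
    (treeNumber (k + 1) : ℝ) * y ^ k / k.factorial ≤ Real.exp 1 * (Real.exp 1 * y) ^ k := by
  have h := treeNumber_succ_div_factorial_le k
  calc (treeNumber (k + 1) : ℝ) * y ^ k / k.factorial
      = (treeNumber (k + 1) : ℝ) / k.factorial * y ^ k := by ring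
    _ ≤ Real.exp 1 ^ (k + 1) * y ^ k := mul_le_mul_of_nonneg_right h (pow_nonneg hy k)
    _ = Real.exp 1 * (Real.exp 1 * y) ^ k := by ring

/-- `t(k+2) yᵏ/k! ≤ e² (k+1) (e y)ᵏ` for `y ≥ 0`. [folklore] -/
theorem treeNumber_succ_succ_mul_pow_div_factorial_le {y : ℝ} (hy : 0 ≤ y) (k : ℕ) :
    (treeNumber (k + 2) : ℝ) * y ^ k / k.factorial ≤
      Real.exp 1 ^ 2 * (k + 1) * (Real.exp 1 * y) ^ k := by
  have h := treeNumber_succ_div_factorial_le (k + 1)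
  have hfac : ((k + 1).factorial : ℝ) = (k + 1) * k.factorial := by
    rw [Nat.factorial_succ]; push_cast; ring
  rw [hfac] at h
  have hk : (0 : ℝ) < k + 1 := by positivity
  have hkf : (0 : ℝ) < k.factorial := by positivity
  rw [div_le_iff₀ (mul_pos hk hkf)] at h
  rw [div_le_iff₀ hkf]
  calc (treeNumber (k + 2) : ℝ) * y ^ k ≤ Real.exp 1 ^ (k + 1 + 1) * ((k + 1) * k.factorial) * y ^ k :=
        mul_le_mul_of_nonneg_right h (pow_nonneg hy k)
    _ = Real.exp 1 ^ 2 * (k + 1) * (Real.exp 1 * y) ^ k * k.factorial := by ring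

/-! ### The canonical quantities along the hydrodynamic scaling `ε_N = σ (N+1)^{-1/3}` -/

variable (P : DensityProfile) (σ : ℝ)

/-- The small parameter `λ = M v₁ σ³` (`= (N+1) p_{ε_N}`). [folklore] -/
def ovDensity : ℝ := P.M * v₁ * σ ^ 3

/-- `Ξ_N(m)`: the hard-core probability of `m` of the `N + 1` particles at scale `ε_N`. [folklore] -/
def XiN (N m : ℕ) : ℝ := Xi P (hsDiameter σ N) (N + 1) m

/-- `q_N(m) = Ξ_N(m) / Ξ_N(m+1)`: the inverse insertion probability of one more particle. [folklore] -/
def qN (N m : ℕ) : ℝ := XiN P σ N m / XiN P σ N (m + 1)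

/-- `r_N(m, j) = Ξ_N(m-j) / Ξ_N(m)`: the inverse insertion probability of `j` particles. [folklore] -/
def rN (N m j : ℕ) : ℝ := XiN P σ N (m - j) / XiN P σ N m

/-- The finite-`N` coefficients `C(m, j) W^g_N(j+1)`. [folklore] -/
def coefN (N : ℕ) (g : T3 → ℝ) (m j : ℕ) : ℝ :=
  (m.choose j : ℝ) * Wd P (hsDiameter σ N) (N + 1) g (j + 1)

/-- The limit coefficients `γ_j ∫ g β^{j+1}`. [folklore] -/
def coefLim (g : T3 → ℝ) (j : ℕ) : ℝ := clusterCoeff σ j * ∫ y, g y * P.β y ^ (j + 1)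

/-- The geometric ratio `θ = 2 e λ` of all the majorant series. [folklore] -/
def geomRatio : ℝ := 2 * Real.exp 1 * ovDensity P σ

variable {P σ}

/-- `p_{ε_N} = λ / (N+1)`. [folklore] -/
theorem pOv_hsDiameter (N : ℕ) : pOv P (hsDiameter σ N) = ovDensity P σ / (N + 1 : ℕ) := by
  rw [pOv, hsDiameter_pow_three, ovDensity]; ring

/-- `0 ≤ λ` for `σ ≥ 0`. [folklore] -/
theorem ovDensity_nonneg (hσ : 0 ≤ σ) : 0 ≤ ovDensity P σ := by
  unfold ovDensity; have := P.M_pos; have := v₁_pos; positivity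

/-- `m p_{ε_N} ≤ λ` for `m ≤ N + 1`. [folklore] -/
theorem mul_pOv_le_ovDensity (hσ : 0 ≤ σ) {N m : ℕ} (hm : m ≤ N + 1) :
    (m : ℝ) * pOv P (hsDiameter σ N) ≤ ovDensity P σ := by
  rw [pOv_hsDiameter]
  have hN : (0 : ℝ) < (N + 1 : ℕ) := by positivity
  rw [mul_div_assoc', div_le_iff₀ hN]
  calc (m : ℝ) * ovDensity P σ ≤ ((N + 1 : ℕ) : ℝ) * ovDensity P σ :=
        mul_le_mul_of_nonneg_right (by exact_mod_cast hm) (ovDensity_nonneg hσ)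
    _ = ovDensity P σ * (N + 1 : ℕ) := mul_comm _ _

section Bounds

variable (hσ : 0 ≤ σ) (hσ2 : σ < 1 / 2)
include hσ hσ2

omit hσ2 in
/-- `0 ≤ ε_N`. [folklore] -/
theorem hsDiameter_nonneg' (N : ℕ) : 0 ≤ hsDiameter σ N := by
  unfold hsDiameter; positivity

/-- `ε_N < 1/2`. [folklore] -/
theorem hsDiameter_lt_half (N : ℕ) : hsDiameter σ N < 1 / 2 :=
  (hsDiameter_le hσ N).trans_lt hσ2

/-- **Insertion bound along the scaling**: `Ξ_N(m) (1 - λ) ≤ Ξ_N(m+1)` for `m ≤ N`. [folklore] -/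
theorem XiN_mul_le_succ {N m : ℕ} (hm : m ≤ N) : XiN P σ N m * (1 - ovDensity P σ) ≤ XiN P σ N (m + 1) := by
  have h := Xi_succ_ge (P := P) (n := N + 1) (hsDiameter_nonneg' hσ N) (hsDiameter_lt_half hσ hσ2 N)
    (m := m) (by omega)
  refine le_trans (mul_le_mul_of_nonneg_left ?_ (Xi_nonneg _)) h
  linarith [mul_pOv_le_ovDensity (P := P) hσ (N := N) (m := m) (by omega)]

variable (hlam : ovDensity P σ < 1)
include hlam

/-- **Positivity of the partition functions**: `0 < Ξ_N(m)` for `m ≤ N + 1`, `λ < 1`. [folklore] -/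
theorem XiN_pos {N m : ℕ} (hm : m ≤ N + 1) : 0 < XiN P σ N m := by
  induction m with
  | zero => rw [XiN, Xi_zero]; exact one_pos
  | succ m ih =>
      have h := XiN_mul_le_succ (P := P) hσ hσ2 (N := N) (m := m) (by omega)
      exact lt_of_lt_of_le (mul_pos (ih (by omega)) (by linarith)) h

/-- `1 ≤ q_N(m)` for `m ≤ N`. [folklore] -/
theorem one_le_qN {N m : ℕ} (hm : m ≤ N) : 1 ≤ qN P σ N m := by
  rw [qN, one_le_div (XiN_pos hσ hσ2 hlam (by omega))]
  exact Xi_succ_le _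

/-- `0 < q_N(m)` for `m ≤ N`. [folklore] -/
theorem qN_pos {N m : ℕ} (hm : m ≤ N) : 0 < qN P σ N m :=
  one_pos.trans_le (one_le_qN hσ hσ2 hlam hm)

/-- `q_N(m) ≤ (1 - λ)⁻¹` for `m ≤ N`. [folklore] -/
theorem qN_le {N m : ℕ} (hm : m ≤ N) : qN P σ N m ≤ (1 - ovDensity P σ)⁻¹ := by
  rw [qN, div_le_iff₀ (XiN_pos hσ hσ2 hlam (by omega)), ← div_eq_inv_mul,
    le_div_iff₀ (by linarith)]
  exact XiN_mul_le_succ hσ hσ2 hm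

/-- `r_N(m, 0) = 1`. [folklore] -/
theorem rN_zero {N m : ℕ} (hm : m ≤ N + 1) : rN P σ N m 0 = 1 := by
  rw [rN, Nat.sub_zero, div_self (XiN_pos hσ hσ2 hlam hm).ne']

/-- The recursion `r_N(m, j+1) = r_N(m, j) q_N(m-1-j)` for `j + 1 ≤ m`. [folklore] -/
theorem rN_succ {N m j : ℕ} (hm : m ≤ N + 1) (hj : j + 1 ≤ m) :
    rN P σ N m (j + 1) = rN P σ N m j * qN P σ N (m - 1 - j) := by
  have h1 : m - 1 - j + 1 = m - j := by omega
  have h2 : m - (j + 1) = m - 1 - j := by omega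
  rw [rN, rN, qN, h1, h2, div_mul_div_comm, mul_comm (XiN P σ N (m - j)),
    mul_div_mul_right _ _ (XiN_pos hσ hσ2 hlam (by omega)).ne']

/-- `1 ≤ r_N(m, j)` for `j ≤ m ≤ N + 1`. [folklore] -/
theorem one_le_rN {N m j : ℕ} (hm : m ≤ N + 1) (hj : j ≤ m) : 1 ≤ rN P σ N m j := by
  induction j with
  | zero => rw [rN_zero hσ hσ2 hlam hm]
  | succ j ih =>
      rw [rN_succ hσ hσ2 hlam hm hj]
      exact one_le_mul_of_one_le_of_one_le (ih (by omega)) (one_le_qN hσ hσ2 hlam (by omega))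

/-- `r_N(m, j) ≤ (1 - λ)^{-j}` for `j ≤ m ≤ N + 1`. [folklore] -/
theorem rN_le {N m j : ℕ} (hm : m ≤ N + 1) (hj : j ≤ m) : rN P σ N m j ≤ (1 - ovDensity P σ)⁻¹ ^ j := by
  induction j with
  | zero => rw [rN_zero hσ hσ2 hlam hm, pow_zero]
  | succ j ih =>
      rw [rN_succ hσ hσ2 hlam hm hj, pow_succ]
      exact mul_le_mul (ih (by omega)) (qN_le hσ hσ2 hlam (by omega)) (qN_pos hσ hσ2 hlam (by omega)).le
        (pow_nonneg (inv_nonneg.2 (by linarith)) _)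

/-- **The ratio identity** (the recursion for `Ξ` divided by `Ξ_N(m)`):
`1 / q_N(m) = ∑_{j ≤ m} C(m, j) W¹_N(j+1) r_N(m, j)` for `m ≤ N`. [folklore] -/
theorem inv_qN_eq_sum {N m : ℕ} (hm : m ≤ N) :
    (qN P σ N m)⁻¹ = ∑ j ∈ range (m + 1), coefN P σ N (fun _ => 1) m j * rN P σ N m j := by
  have hpos := XiN_pos hσ hσ2 hlam (N := N) (m := m) (by omega)
  rw [qN, inv_div, XiN, XiN, Xi_eq_sum (P := P) (n := N + 1) (m := m + 1) (by omega) (by omega),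
    sum_div]
  refine sum_congr rfl fun j hj => ?_
  have hjm : j ≤ m := Nat.lt_succ_iff.mp (mem_range.mp hj)
  rw [coefN, rN, XiN, XiN, show m + 1 - 1 = m from rfl]
  ring

end Bounds

/-- `0 ≤ θ` for `σ ≥ 0`. [folklore] -/
theorem geomRatio_nonneg (hσ : 0 ≤ σ) : 0 ≤ geomRatio P σ := by
  unfold geomRatio; have := ovDensity_nonneg (P := P) hσ; positivity

/-! ### Bounds and limits of the coefficients -/

/-- **Uniform bound on the coefficients**: `|C(m, j) W^g_N(j+1)| ≤ C e (e λ)ʲ` for `|g| ≤ C`,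
`j ≤ N`, `m ≤ N + 1` (tree bound, `C(m, j) ≤ mʲ/j!`, `m p_{ε_N} ≤ λ`). [folklore] -/
theorem abs_coefN_le (hσ : 0 ≤ σ) (hσ2 : σ < 1 / 2) {g : T3 → ℝ} (hg : Measurable g) {C : ℝ}
    (hgC : ∀ y, |g y| ≤ C) {N m j : ℕ} (hj : j ≤ N) (hm : m ≤ N + 1) :
    |coefN P σ N g m j| ≤ C * (Real.exp 1 * (Real.exp 1 * ovDensity P σ) ^ j) := by
  have hC : 0 ≤ C := (abs_nonneg _).trans (hgC 0)
  have hp : 0 ≤ pOv P (hsDiameter σ N) := pOv_nonneg P (hsDiameter_nonneg' hσ N)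
  have hW := abs_Wd_le (P := P) (n := N + 1) (hsDiameter_nonneg' hσ N) (hsDiameter_lt_half hσ hσ2 N)
    hg hgC (k := j + 1) (by omega) (by omega)
  rw [Nat.add_sub_cancel] at hW
  have hchoose : (m.choose j : ℝ) ≤ (m : ℝ) ^ j / j.factorial := Nat.choose_le_pow_div j m
  rw [coefN, abs_mul, Nat.abs_cast]
  calc (m.choose j : ℝ) * |Wd P (hsDiameter σ N) (N + 1) g (j + 1)|
      ≤ ((m : ℝ) ^ j / j.factorial) * (C * (treeNumber (j + 1) * pOv P (hsDiameter σ N) ^ j)) :=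
        mul_le_mul hchoose hW (abs_nonneg _) (by positivity)
    _ = C * ((treeNumber (j + 1) : ℝ) * ((m : ℝ) * pOv P (hsDiameter σ N)) ^ j / j.factorial) := by
        rw [mul_pow]; ring
    _ ≤ C * ((treeNumber (j + 1) : ℝ) * (ovDensity P σ) ^ j / j.factorial) := by
        gcongr
        exact mul_pOv_le_ovDensity hσ hm
    _ ≤ C * (Real.exp 1 * (Real.exp 1 * ovDensity P σ) ^ j) :=
        mul_le_mul_of_nonneg_left (treeNumber_succ_mul_pow_div_factorial_le (ovDensity_nonneg hσ) j) hC

/-- **The coefficients converge** (the cluster limit of `HardSphereCanonicalTorus`): for every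
shift `s`, `C(N - s, j) W^g_N(j+1) → γ_j ∫ g β^{j+1}`. [folklore] -/
theorem tendsto_coefN (hσ : 0 < σ) (s j : ℕ) {g : T3 → ℝ} (hg : Measurable g) {C : ℝ}
    (hgC : ∀ y, |g y| ≤ C) :
    Tendsto (fun N => coefN P σ N g (N - s) j) atTop (𝓝 (coefLim P σ g j)) :=
  tendsto_choose_sub_mul_Wd P hσ s j hg hgC

/-- The limit coefficients obey the same bound: `|γ_j ∫ g β^{j+1}| ≤ C e (e λ)ʲ`. [folklore] -/
theorem abs_coefLim_le (hσ : 0 < σ) (hσ2 : σ < 1 / 2) {g : T3 → ℝ} (hg : Measurable g) {C : ℝ}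
    (hgC : ∀ y, |g y| ≤ C) (j : ℕ) :
    |coefLim P σ g j| ≤ C * (Real.exp 1 * (Real.exp 1 * ovDensity P σ) ^ j) := by
  have h := (tendsto_coefN (P := P) hσ 0 j hg hgC).abs
  refine le_of_tendsto h ?_
  filter_upwards [eventually_ge_atTop j] with N hN
  exact abs_coefN_le hσ.le hσ2 hg hgC (by omega) (by omega)

/-- The zeroth coefficient with `g = 1` is `1` (`W¹(1) = ∫ dμ = 1`). [folklore] -/
theorem coefN_one_zero (N m : ℕ) : coefN P σ N (fun _ => 1) m 0 = 1 := by
  rw [coefN, Nat.choose_zero_right, Nat.cast_one, one_mul, zero_add, Wd_one measurable_const]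
  simp

/-- The zeroth limit coefficient with `g = 1` is `1`. [folklore] -/
theorem coefLim_one_zero (hσ : 0 < σ) : coefLim P σ (fun _ => 1) 0 = 1 := by
  have h := tendsto_coefN (P := P) hσ 0 0 (g := fun _ => (1 : ℝ)) measurable_const (C := 1)
    (fun _ => by simp)
  simp_rw [coefN_one_zero] at h
  exact tendsto_nhds_unique h tendsto_const_nhds

/-! ### The limit equation for the insertion ratio -/

/-- The power series `F(R) = ∑_j γ_j (∫ β^{j+1}) Rʲ` of the limit recursion. [folklore] -/
def ratioSeries (P : DensityProfile) (σ : ℝ) (R : ℝ) : ℝ := ∑' j, coefLim P σ (fun _ => 1) j * R ^ j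

/-- Termwise bound `|γ_j (∫β^{j+1}) Rʲ| ≤ e θʲ` for `|R| ≤ 2`. [folklore] -/
theorem abs_coefLim_one_mul_pow_le (hσ : 0 < σ) (hσ2 : σ < 1 / 2) {R : ℝ} (hR : |R| ≤ 2) (j : ℕ) :
    |coefLim P σ (fun _ => 1) j * R ^ j| ≤ Real.exp 1 * geomRatio P σ ^ j := by
  rw [abs_mul, abs_pow, geomRatio]
  have h := abs_coefLim_le (P := P) hσ hσ2 (g := fun _ => (1 : ℝ)) measurable_const (C := 1)
    (fun _ => by simp) j
  rw [one_mul] at h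
  calc |coefLim P σ (fun _ => 1) j| * |R| ^ j ≤ (Real.exp 1 * (Real.exp 1 * ovDensity P σ) ^ j) * 2 ^ j :=
        mul_le_mul h (pow_le_pow_left₀ (abs_nonneg _) hR j) (by positivity)
          (mul_nonneg (Real.exp_pos 1).le (pow_nonneg (mul_nonneg (Real.exp_pos 1).le (ovDensity_nonneg hσ.le)) j))
    _ = Real.exp 1 * (2 * Real.exp 1 * ovDensity P σ) ^ j := by ring

/-- The terms of `F` are summable for `|R| ≤ 2` when `θ < 1`. [folklore] -/
theorem summable_ratioSeries (hσ : 0 < σ) (hσ2 : σ < 1 / 2) (hθ : geomRatio P σ < 1) {R : ℝ} (hR : |R| ≤ 2) :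
    Summable fun j => coefLim P σ (fun _ => 1) j * R ^ j :=
  Summable.of_norm_bounded ((summable_geometric_of_lt_one (geomRatio_nonneg hσ.le) hθ).mul_left _)
    fun j => (Real.norm_eq_abs _).trans_le (abs_coefLim_one_mul_pow_le hσ hσ2 hR j)

/-- `F` is continuous on `[0, 2]`. [folklore] -/
theorem continuousOn_ratioSeries (hσ : 0 < σ) (hσ2 : σ < 1 / 2) (hθ : geomRatio P σ < 1) :
    ContinuousOn (ratioSeries P σ) (Set.Icc 0 2) := by
  refine continuousOn_tsum (fun j => (continuous_const.mul (continuous_pow j)).continuousOn)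
    ((summable_geometric_of_lt_one (geomRatio_nonneg hσ.le) hθ).mul_left (Real.exp 1)) ?_
  intro j R hR
  exact (Real.norm_eq_abs _).trans_le
    (abs_coefLim_one_mul_pow_le hσ hσ2 (abs_le.2 ⟨by linarith [hR.1], hR.2⟩) j)

/-- `|F(R) - 1| ≤ e θ / (1 - θ)` for `|R| ≤ 2`. [folklore] -/
theorem abs_ratioSeries_sub_one_le (hσ : 0 < σ) (hσ2 : σ < 1 / 2) (hθ : geomRatio P σ < 1) {R : ℝ} (hR : |R| ≤ 2) :
    |ratioSeries P σ R - 1| ≤ Real.exp 1 * geomRatio P σ / (1 - geomRatio P σ) := by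
  have hθ0 := geomRatio_nonneg (P := P) hσ.le
  rw [ratioSeries, (summable_ratioSeries hσ hσ2 hθ hR).tsum_eq_zero_add, coefLim_one_zero hσ, pow_zero, mul_one,
    add_sub_cancel_left]
  have hgeo : HasSum (fun j : ℕ => Real.exp 1 * geomRatio P σ ^ (j + 1))
      (Real.exp 1 * geomRatio P σ / (1 - geomRatio P σ)) := by
    have h := (hasSum_geometric_of_lt_one hθ0 hθ).mul_left (Real.exp 1 * geomRatio P σ)
    rw [div_eq_mul_inv]
    refine h.congr_fun ?_
    intro j; ring
  refine (Real.norm_eq_abs _).symm.trans_le (tsum_of_norm_bounded hgeo fun j => ?_)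
  exact (Real.norm_eq_abs _).trans_le (abs_coefLim_one_mul_pow_le hσ hσ2 hR (j + 1))

/-- **Existence of the limit ratio**: if `e θ / (1 - θ) < 1/2` there is `R ∈ [1/2, 2]` with
`R F(R) = 1` (intermediate value theorem). [folklore] -/
theorem exists_ratio (hσ : 0 < σ) (hσ2 : σ < 1 / 2) (hθ : geomRatio P σ < 1)
    (hφ : Real.exp 1 * geomRatio P σ / (1 - geomRatio P σ) < 1 / 2) :
    ∃ R ∈ Set.Icc (1 / 2 : ℝ) 2, R * ratioSeries P σ R = 1 := by
  have hcont : ContinuousOn (fun R => R * ratioSeries P σ R) (Set.Icc (1 / 2 : ℝ) 2) :=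
    continuousOn_id.mul ((continuousOn_ratioSeries hσ hσ2 hθ).mono (Set.Icc_subset_Icc (by norm_num) le_rfl))
  have h1 := abs_ratioSeries_sub_one_le (P := P) hσ hσ2 hθ (R := 1 / 2) (by rw [abs_of_pos (by norm_num)]; norm_num)
  have h2 := abs_ratioSeries_sub_one_le (P := P) hσ hσ2 hθ (R := 2) (by rw [abs_of_pos (by norm_num)])
  rw [abs_le] at h1 h2
  have hmem : (1 : ℝ) ∈ Set.Icc ((1 / 2 : ℝ) * ratioSeries P σ (1 / 2)) (2 * ratioSeries P σ 2) := by
    constructor <;> nlinarith [h1.2, h2.1]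
  obtain ⟨R, hR, hR1⟩ := intermediate_value_Icc (by norm_num : (1 / 2 : ℝ) ≤ 2) hcont hmem
  exact ⟨R, hR, hR1⟩

/-- **The limit ratio** `R(σ)`: a solution in `[1/2, 2]` of `R F(R) = 1` (the thermodynamic
limit of the inverse insertion probability `Ξ_N(N)/Ξ_N(N+1)`). [folklore] -/
def ratioLimit (P : DensityProfile) (σ : ℝ) : ℝ :=
  Classical.epsilon fun R => R ∈ Set.Icc (1 / 2 : ℝ) 2 ∧ R * ratioSeries P σ R = 1

/-- The defining property of the limit ratio. [folklore] -/
theorem ratioLimit_spec (hσ : 0 < σ) (hσ2 : σ < 1 / 2) (hθ : geomRatio P σ < 1)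
    (hφ : Real.exp 1 * geomRatio P σ / (1 - geomRatio P σ) < 1 / 2) :
    ratioLimit P σ ∈ Set.Icc (1 / 2 : ℝ) 2 ∧ ratioLimit P σ * ratioSeries P σ (ratioLimit P σ) = 1 := by
  obtain ⟨R, hR, hR1⟩ := exists_ratio (P := P) hσ hσ2 hθ hφ
  exact Classical.epsilon_spec (p := fun R => R ∈ Set.Icc (1 / 2 : ℝ) 2 ∧ R * ratioSeries P σ R = 1) ⟨R, hR, hR1⟩


/-! ### Convergence of the insertion ratios -/

/-- The contraction constant `κ = e θ / (1 - θ)²` (`= e ∑_j j θʲ`). [folklore] -/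
def contractionC (P : DensityProfile) (σ : ℝ) : ℝ := Real.exp 1 * geomRatio P σ / (1 - geomRatio P σ) ^ 2

/-- The geometric tail `e θ^{J+1} / (1 - θ)` (`= e ∑_{j > J} θʲ`). [folklore] -/
def geomTail (P : DensityProfile) (σ : ℝ) (J : ℕ) : ℝ := Real.exp 1 * geomRatio P σ ^ (J + 1) / (1 - geomRatio P σ)

/-- **Smallness of the reduced density.** The explicit conditions on `σ` (given the profile `β`)
under which the contraction argument runs: `0 < σ < 1/2`, `λ ≤ 1/2`, `θ < 1`, `eθ/(1-θ) < 1/2`,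
`4κ < 1`; all hold for `σ < σ₀(β)` (`HardSphereEulerLLN`). [folklore] -/
structure SmallDensity (P : DensityProfile) (σ : ℝ) : Prop where
  σ_pos : 0 < σ
  σ_lt_half : σ < 1 / 2
  ovDensity_le_half : ovDensity P σ ≤ 1 / 2
  geomRatio_lt_one : geomRatio P σ < 1
  phi_lt_half : Real.exp 1 * geomRatio P σ / (1 - geomRatio P σ) < 1 / 2
  four_contractionC_lt_one : 4 * contractionC P σ < 1

namespace SmallDensity

variable (h : SmallDensity P σ)
include h

/-- `λ < 1`. [folklore] -/
theorem ovDensity_lt_one : ovDensity P σ < 1 := by linarith [h.ovDensity_le_half]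

/-- `(1 - λ)⁻¹ ≤ 2`. [folklore] -/
theorem inv_one_sub_ovDensity_le : (1 - ovDensity P σ)⁻¹ ≤ 2 := by
  have := h.ovDensity_le_half
  rw [inv_le_comm₀ (by linarith) (by norm_num)]; linarith

/-- `q_N(m) ≤ 2` for `m ≤ N`. [folklore] -/
theorem qN_le_two {N m : ℕ} (hm : m ≤ N) : qN P σ N m ≤ 2 :=
  (qN_le h.σ_pos.le h.σ_lt_half h.ovDensity_lt_one hm).trans h.inv_one_sub_ovDensity_le

/-- `r_N(m, j) ≤ 2ʲ` for `j ≤ m ≤ N + 1`. [folklore] -/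
theorem rN_le_two_pow {N m j : ℕ} (hm : m ≤ N + 1) (hj : j ≤ m) : rN P σ N m j ≤ 2 ^ j :=
  (rN_le h.σ_pos.le h.σ_lt_half h.ovDensity_lt_one hm hj).trans
    (pow_le_pow_left₀ (inv_nonneg.2 (by linarith [h.ovDensity_le_half])) h.inv_one_sub_ovDensity_le j)

/-- `1/2 ≤ R ≤ 2`. [folklore] -/
theorem ratioLimit_mem : ratioLimit P σ ∈ Set.Icc (1 / 2 : ℝ) 2 :=
  (ratioLimit_spec h.σ_pos h.σ_lt_half h.geomRatio_lt_one h.phi_lt_half).1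

/-- `0 < R`. [folklore] -/
theorem ratioLimit_pos : 0 < ratioLimit P σ := by
  have := h.ratioLimit_mem.1; linarith

/-- **The limit equation**: `R⁻¹ = F(R) = ∑_j γ_j (∫β^{j+1}) Rʲ`. [folklore] -/
theorem inv_ratioLimit_eq : (ratioLimit P σ)⁻¹ = ratioSeries P σ (ratioLimit P σ) := by
  have h1 := (ratioLimit_spec h.σ_pos h.σ_lt_half h.geomRatio_lt_one h.phi_lt_half).2
  have hR := h.ratioLimit_pos
  field_simp
  linarith

/-- `|R| ≤ 2`. [folklore] -/
theorem abs_ratioLimit_le : |ratioLimit P σ| ≤ 2 := by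
  rw [abs_of_pos h.ratioLimit_pos]
  exact h.ratioLimit_mem.2

/-- `0 ≤ θ`. [folklore] -/
theorem geomRatio_nonneg : 0 ≤ geomRatio P σ := KineticTheory.geomRatio_nonneg h.σ_pos.le

/-- `0 ≤ λ`. [folklore] -/
theorem ovDensity_nonneg : 0 ≤ ovDensity P σ := KineticTheory.ovDensity_nonneg h.σ_pos.le

/-- `0 ≤ κ`. [folklore] -/
theorem contractionC_nonneg : 0 ≤ contractionC P σ := by
  unfold contractionC; have := h.geomRatio_nonneg; positivity

/-- `0 ≤ geomTail J`. [folklore] -/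
theorem geomTail_nonneg (J : ℕ) : 0 ≤ geomTail P σ J := by
  unfold geomTail; have := h.geomRatio_nonneg
  exact div_nonneg (by positivity) (by linarith [h.geomRatio_lt_one])

/-- **Products of ratios**: if `|q_N(m-1-i) - R| ≤ η` for all `i < j` then
`|r_N(m, j) - Rʲ| ≤ j 2ʲ η` (`j ≤ m ≤ N + 1`). [folklore] -/
theorem abs_rN_sub_pow_le {N m : ℕ} (hm : m ≤ N + 1) {η : ℝ} :
    ∀ {j : ℕ}, j ≤ m → (∀ i < j, |qN P σ N (m - 1 - i) - ratioLimit P σ| ≤ η) →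
      |rN P σ N m j - ratioLimit P σ ^ j| ≤ j * 2 ^ j * η := by
  intro j
  induction j with
  | zero =>
      intro _ _
      rw [rN_zero h.σ_pos.le h.σ_lt_half h.ovDensity_lt_one hm, pow_zero, sub_self, abs_zero]
      simp
  | succ j ih =>
      intro hj hq
      have hη : 0 ≤ η := (abs_nonneg _).trans (hq j (Nat.lt_succ_self j))
      have ih' := ih (by omega) fun i hi => hq i (Nat.lt_succ_of_lt hi)
      have hqj := hq j (Nat.lt_succ_self j)
      rw [rN_succ h.σ_pos.le h.σ_lt_half h.ovDensity_lt_one hm hj, pow_succ]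
      have hrr0 : 0 ≤ rN P σ N m j :=
        zero_le_one.trans (one_le_rN h.σ_pos.le h.σ_lt_half h.ovDensity_lt_one hm (by omega))
      have hrr2 : rN P σ N m j ≤ 2 ^ j := h.rN_le_two_pow hm (by omega)
      have hR0 := h.ratioLimit_pos
      have hR2 := (h.ratioLimit_mem).2
      have hsplit : rN P σ N m j * qN P σ N (m - 1 - j) - ratioLimit P σ ^ j * ratioLimit P σ =
          rN P σ N m j * (qN P σ N (m - 1 - j) - ratioLimit P σ) +
            (rN P σ N m j - ratioLimit P σ ^ j) * ratioLimit P σ := by ring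
      rw [hsplit]
      calc |rN P σ N m j * (qN P σ N (m - 1 - j) - ratioLimit P σ) +
            (rN P σ N m j - ratioLimit P σ ^ j) * ratioLimit P σ|
          ≤ |rN P σ N m j * (qN P σ N (m - 1 - j) - ratioLimit P σ)| +
            |(rN P σ N m j - ratioLimit P σ ^ j) * ratioLimit P σ| := abs_add_le _ _
        _ = rN P σ N m j * |qN P σ N (m - 1 - j) - ratioLimit P σ| +
            |rN P σ N m j - ratioLimit P σ ^ j| * ratioLimit P σ := by
            rw [abs_mul, abs_mul, abs_of_nonneg hrr0, abs_of_pos hR0]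
        _ ≤ 2 ^ j * η + (j * 2 ^ j * η) * 2 := by
            gcongr
        _ ≤ (j + 1 : ℕ) * 2 ^ (j + 1) * η := by
            have h2j : (0 : ℝ) ≤ 2 ^ j * η := mul_nonneg (pow_nonneg zero_le_two j) hη
            push_cast
            rw [pow_succ]
            nlinarith [h2j]

/-- The partial sums `e ∑_{j ≤ J} j θʲ ≤ κ`. [folklore] -/
theorem sum_mul_geomRatio_pow_le (J : ℕ) :
    Real.exp 1 * ∑ j ∈ range (J + 1), (j : ℝ) * geomRatio P σ ^ j ≤ contractionC P σ := by
  have hθ0 := h.geomRatio_nonneg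
  have h := hasSum_coe_mul_geometric_of_norm_lt_one (𝕜 := ℝ) (r := geomRatio P σ)
    (by rw [Real.norm_eq_abs, abs_of_nonneg hθ0]; exact h.geomRatio_lt_one)
  rw [contractionC, mul_div_assoc]
  exact mul_le_mul_of_nonneg_left (sum_le_hasSum _ (fun j _ => by positivity) h) (Real.exp_pos 1).le

/-- The geometric tails `e ∑_{J < j ≤ K} θʲ ≤ geomTail J`. [folklore] -/
theorem sum_Ico_geomRatio_pow_le (J K : ℕ) :
    Real.exp 1 * ∑ j ∈ Ico (J + 1) K, geomRatio P σ ^ j ≤ geomTail P σ J := by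
  have hθ0 := h.geomRatio_nonneg
  rw [geomTail, mul_div_assoc]
  refine mul_le_mul_of_nonneg_left ?_ (Real.exp_pos 1).le
  rw [Finset.sum_Ico_eq_sum_range]
  have h := (hasSum_geometric_of_lt_one hθ0 h.geomRatio_lt_one).mul_left (geomRatio P σ ^ (J + 1))
  rw [← div_eq_mul_inv] at h
  refine le_trans (le_of_eq ?_) (sum_le_hasSum (range (K - (J + 1))) (fun j _ => by positivity) h)
  exact sum_congr rfl fun j _ => by rw [pow_add]

/-- The tail of the limit series `|∑_{j > J} γ_j (∫β^{j+1}) R^j| ≤ geomTail J`. [folklore] -/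
theorem abs_tsum_tail_le (J : ℕ) :
    |∑' j, coefLim P σ (fun _ => 1) (j + (J + 1)) * ratioLimit P σ ^ (j + (J + 1))| ≤ geomTail P σ J := by
  have hθ0 := h.geomRatio_nonneg
  have hgeo : HasSum (fun j : ℕ => Real.exp 1 * geomRatio P σ ^ (j + (J + 1))) (geomTail P σ J) := by
    have h := (hasSum_geometric_of_lt_one hθ0 h.geomRatio_lt_one).mul_left (Real.exp 1 * geomRatio P σ ^ (J + 1))
    rw [geomTail, div_eq_mul_inv]
    refine h.congr_fun fun j => ?_
    rw [pow_add]; ring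
  refine (Real.norm_eq_abs _).symm.trans_le (tsum_of_norm_bounded hgeo fun j => ?_)
  exact (Real.norm_eq_abs _).trans_le
    (abs_coefLim_one_mul_pow_le h.σ_pos h.σ_lt_half h.abs_ratioLimit_le _)

/-- **The deterministic estimate.** Let `m = N - l ≥ J`. If `|q_N(m-1-i) - R| ≤ η` for `i < J`
and `|C(m,j) W¹_N(j+1) - γ_j ∫β^{j+1}| ≤ τ` for `j ≤ J`, then
`|1/q_N(m) - 1/R| ≤ (J+1) 2ᴶ τ + κ η + 2 geomTail J`. [folklore] -/
theorem abs_inv_qN_sub_inv_le {N l J : ℕ} (hJ : l + J ≤ N) {η τ : ℝ} (hη : 0 ≤ η) (hτ : 0 ≤ τ)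
    (hq : ∀ i < J, |qN P σ N (N - l - 1 - i) - ratioLimit P σ| ≤ η)
    (hc : ∀ j ≤ J, |coefN P σ N (fun _ => 1) (N - l) j - coefLim P σ (fun _ => 1) j| ≤ τ) :
    |(qN P σ N (N - l))⁻¹ - (ratioLimit P σ)⁻¹| ≤
      (J + 1) * 2 ^ J * τ + contractionC P σ * η + 2 * geomTail P σ J := by
  set m := N - l with hm_def
  set R := ratioLimit P σ with hR_def
  have hmN : m ≤ N := Nat.sub_le N l
  have hJm : J ≤ m := by omega
  have hlam1 := h.ovDensity_lt_one
  have hθ0 := h.geomRatio_nonneg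
  have hlam0 := h.ovDensity_nonneg
  have hRabs := h.abs_ratioLimit_le
  set a : ℕ → ℝ := fun j => coefN P σ N (fun _ => 1) m j * rN P σ N m j with ha
  set b : ℕ → ℝ := fun j => coefLim P σ (fun _ => 1) j * R ^ j with hb
  have hsum_b : Summable b := summable_ratioSeries h.σ_pos h.σ_lt_half h.geomRatio_lt_one hRabs
  -- the two decompositions
  have hq_eq : (qN P σ N m)⁻¹ = ∑ j ∈ range (J + 1), a j + ∑ j ∈ Ico (J + 1) (m + 1), a j := by
    rw [inv_qN_eq_sum h.σ_pos.le h.σ_lt_half hlam1 hmN, Finset.sum_range_add_sum_Ico _ (by omega)]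
  have hR_eq : R⁻¹ = ∑ j ∈ range (J + 1), b j + ∑' j, b (j + (J + 1)) := by
    rw [hR_def, h.inv_ratioLimit_eq, ratioSeries, ← hsum_b.sum_add_tsum_nat_add (J + 1)]
  -- head terms
  have hhead : ∀ j ∈ range (J + 1), |a j - b j| ≤ 2 ^ J * τ + Real.exp 1 * ((j : ℝ) * geomRatio P σ ^ j) * η := by
    intro j hj
    have hjJ : j ≤ J := Nat.lt_succ_iff.mp (mem_range.mp hj)
    have hrr0 : 0 ≤ rN P σ N m j := zero_le_one.trans (one_le_rN h.σ_pos.le h.σ_lt_half hlam1 (by omega) (by omega))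
    have hrr2 : rN P σ N m j ≤ 2 ^ J :=
      (h.rN_le_two_pow (by omega) (by omega)).trans
        (pow_le_pow_right₀ (by norm_num) hjJ)
    have hrrR : |rN P σ N m j - R ^ j| ≤ j * 2 ^ j * η :=
      h.abs_rN_sub_pow_le (by omega) (by omega) fun i hi => hq i (by omega)
    have hcj := hc j hjJ
    have hcl := abs_coefLim_le (P := P) h.σ_pos h.σ_lt_half (g := fun _ => (1 : ℝ)) measurable_const (C := 1)
      (fun _ => by simp) j
    rw [one_mul] at hcl
    have hsplit : a j - b j = (coefN P σ N (fun _ => 1) m j - coefLim P σ (fun _ => 1) j) * rN P σ N m j +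
        coefLim P σ (fun _ => 1) j * (rN P σ N m j - R ^ j) := by
      simp only [ha, hb]; ring
    rw [hsplit]
    calc |(coefN P σ N (fun _ => 1) m j - coefLim P σ (fun _ => 1) j) * rN P σ N m j +
          coefLim P σ (fun _ => 1) j * (rN P σ N m j - R ^ j)|
        ≤ |coefN P σ N (fun _ => 1) m j - coefLim P σ (fun _ => 1) j| * rN P σ N m j +
          |coefLim P σ (fun _ => 1) j| * |rN P σ N m j - R ^ j| := by
          refine (abs_add_le _ _).trans (le_of_eq ?_)
          rw [abs_mul, abs_mul, abs_of_nonneg hrr0]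
      _ ≤ τ * 2 ^ J + (Real.exp 1 * (Real.exp 1 * ovDensity P σ) ^ j) * (j * 2 ^ j * η) :=
          add_le_add (mul_le_mul hcj hrr2 hrr0 hτ)
            (mul_le_mul hcl hrrR (abs_nonneg _) (by positivity))
      _ = 2 ^ J * τ + Real.exp 1 * ((j : ℝ) * geomRatio P σ ^ j) * η := by
          rw [geomRatio, show (2 * Real.exp 1 * ovDensity P σ) ^ j = 2 ^ j * (Real.exp 1 * ovDensity P σ) ^ j by
            rw [← mul_pow]; ring_nf]
          ring
  have hhead_sum : |∑ j ∈ range (J + 1), (a j - b j)| ≤ (J + 1) * 2 ^ J * τ + contractionC P σ * η := by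
    refine (abs_sum_le_sum_abs _ _).trans ?_
    refine (sum_le_sum hhead).trans ?_
    have hs : ∑ j ∈ range (J + 1), (2 ^ J * τ + Real.exp 1 * ((j : ℝ) * geomRatio P σ ^ j) * η) =
        (J + 1) * 2 ^ J * τ + (Real.exp 1 * ∑ j ∈ range (J + 1), (j : ℝ) * geomRatio P σ ^ j) * η := by
      rw [sum_add_distrib, sum_const, card_range, nsmul_eq_mul, Finset.mul_sum, Finset.sum_mul]
      push_cast
      ring
    rw [hs]
    have := h.sum_mul_geomRatio_pow_le J
    nlinarith
  -- tail of the finite sum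
  have htail_a : |∑ j ∈ Ico (J + 1) (m + 1), a j| ≤ geomTail P σ J := by
    refine (abs_sum_le_sum_abs _ _).trans ?_
    have hterm : ∀ j ∈ Ico (J + 1) (m + 1), |a j| ≤ Real.exp 1 * geomRatio P σ ^ j := by
      intro j hj
      have hjm : j ≤ m := Nat.lt_succ_iff.mp (mem_Ico.mp hj).2
      have hrr0 : 0 ≤ rN P σ N m j := zero_le_one.trans (one_le_rN h.σ_pos.le h.σ_lt_half hlam1 (by omega) hjm)
      have hrr2 : rN P σ N m j ≤ 2 ^ j := h.rN_le_two_pow (by omega) hjm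
      have hco := abs_coefN_le (P := P) h.σ_pos.le h.σ_lt_half (g := fun _ => (1 : ℝ)) measurable_const (C := 1)
        (fun _ => by simp) (N := N) (m := m) (j := j) (by omega) (by omega)
      rw [one_mul] at hco
      simp only [ha, abs_mul, abs_of_nonneg hrr0]
      calc |coefN P σ N (fun _ => 1) m j| * rN P σ N m j
          ≤ (Real.exp 1 * (Real.exp 1 * ovDensity P σ) ^ j) * 2 ^ j :=
            mul_le_mul hco hrr2 hrr0 (by positivity)
        _ = Real.exp 1 * geomRatio P σ ^ j := by rw [geomRatio, mul_assoc, ← mul_pow]; ring_nf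
    refine (sum_le_sum hterm).trans ?_
    rw [← mul_sum]
    exact h.sum_Ico_geomRatio_pow_le J (m + 1)
  have htail_b : |∑' j, b (j + (J + 1))| ≤ geomTail P σ J := h.abs_tsum_tail_le J
  -- assemble
  have hdiff : (qN P σ N m)⁻¹ - R⁻¹ = ∑ j ∈ range (J + 1), (a j - b j) +
      ∑ j ∈ Ico (J + 1) (m + 1), a j - ∑' j, b (j + (J + 1)) := by
    rw [hq_eq, hR_eq, sum_sub_distrib]; ring
  rw [hdiff]
  calc |∑ j ∈ range (J + 1), (a j - b j) + ∑ j ∈ Ico (J + 1) (m + 1), a j - ∑' j, b (j + (J + 1))|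
      ≤ |∑ j ∈ range (J + 1), (a j - b j)| + |∑ j ∈ Ico (J + 1) (m + 1), a j| +
          |∑' j, b (j + (J + 1))| := abs_sub_le_of_le_of_le' _ _ _
    _ ≤ _ := by linarith
  where
    abs_sub_le_of_le_of_le' (x y z : ℝ) : |x + y - z| ≤ |x| + |y| + |z| := by
      calc |x + y - z| ≤ |x + y| + |z| := abs_sub _ _
        _ ≤ |x| + |y| + |z| := by gcongr; exact abs_add_le x y

/-- From inverses to the ratios: `|q - R| ≤ 4 |q⁻¹ - R⁻¹|` (`q ∈ [1, 2]`, `R ∈ [1/2, 2]`). [folklore] -/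
theorem abs_qN_sub_le_of_inv {N m : ℕ} (hm : m ≤ N) :
    |qN P σ N m - ratioLimit P σ| ≤ 4 * |(qN P σ N m)⁻¹ - (ratioLimit P σ)⁻¹| := by
  have hlam1 := h.ovDensity_lt_one
  have hq0 := qN_pos h.σ_pos.le h.σ_lt_half hlam1 hm
  have hq2 := h.qN_le_two hm
  have hR0 := h.ratioLimit_pos
  have hR2 := (h.ratioLimit_mem).2
  have key : qN P σ N m - ratioLimit P σ =
      qN P σ N m * ratioLimit P σ * ((ratioLimit P σ)⁻¹ - (qN P σ N m)⁻¹) := by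
    field_simp
  rw [key, abs_mul, abs_mul, abs_of_pos hq0, abs_of_pos hR0, abs_sub_comm]
  have h4 : qN P σ N m * ratioLimit P σ ≤ 4 := by nlinarith
  exact mul_le_mul_of_nonneg_right h4 (abs_nonneg _)

/-- **The improvement step.** If eventually (in `N`, for every fixed shift `l`)
`|q_N(N-l) - R| ≤ η`, then for every `J` and `τ > 0`, eventually
`|q_N(N-l) - R| ≤ 4 ((J+1) 2ᴶ τ + κ η + 2 geomTail J)`. [folklore] -/
theorem eventually_abs_qN_sub_le_step {η : ℝ} (hη : 0 ≤ η)
    (H : ∀ l : ℕ, ∀ᶠ N in atTop, |qN P σ N (N - l) - ratioLimit P σ| ≤ η) (J : ℕ) {τ : ℝ}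
    (hτ : 0 < τ) (l : ℕ) :
    ∀ᶠ N in atTop, |qN P σ N (N - l) - ratioLimit P σ| ≤
      4 * ((J + 1) * 2 ^ J * τ + contractionC P σ * η + 2 * geomTail P σ J) := by
  -- the shifted ratios
  have h1 : ∀ᶠ N in atTop, ∀ i ∈ range J, |qN P σ N (N - l - 1 - i) - ratioLimit P σ| ≤ η := by
    rw [eventually_all_finset]
    intro i _
    refine (H (l + 1 + i)).mono fun N hN => ?_
    rwa [show N - l - 1 - i = N - (l + 1 + i) by omega]
  -- the coefficients
  have h2 : ∀ᶠ N in atTop, ∀ j ∈ range (J + 1),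
      |coefN P σ N (fun _ => 1) (N - l) j - coefLim P σ (fun _ => 1) j| ≤ τ := by
    rw [eventually_all_finset]
    intro j _
    have h := tendsto_coefN (P := P) h.σ_pos l j (g := fun _ => (1 : ℝ)) measurable_const (C := 1)
      (fun _ => by simp)
    refine ((Metric.tendsto_nhds.mp h) τ hτ).mono fun N hN => ?_
    rw [Real.dist_eq] at hN
    exact hN.le
  filter_upwards [h1, h2, eventually_ge_atTop (l + J)] with N hN1 hN2 hN3
  refine (h.abs_qN_sub_le_of_inv (Nat.sub_le N l)).trans ?_
  refine mul_le_mul_of_nonneg_left ?_ (by norm_num)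
  exact h.abs_inv_qN_sub_inv_le hN3 hη hτ.le
    (fun i hi => hN1 i (mem_range.mpr hi)) (fun j hj => hN2 j (mem_range.mpr (Nat.lt_succ_of_le hj)))

/-- **Convergence of the insertion ratios**: `q_N(N - l) → R(σ)` for every fixed `l`.
[folklore] -/
theorem tendsto_qN_sub (l : ℕ) :
    Tendsto (fun N => qN P σ N (N - l)) atTop (𝓝 (ratioLimit P σ)) := by
  have hκ0 : 0 ≤ contractionC P σ := h.contractionC_nonneg
  have hA0 : 0 ≤ 4 * contractionC P σ := by positivity
  have hA1 : 4 * contractionC P σ < 1 := h.four_contractionC_lt_one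
  -- the trivial initial bound
  have H0 : ∀ l : ℕ, ∀ᶠ N in atTop, |qN P σ N (N - l) - ratioLimit P σ| ≤ 4 := by
    intro l
    refine Eventually.of_forall fun N => ?_
    have hq0 := qN_pos h.σ_pos.le h.σ_lt_half h.ovDensity_lt_one (Nat.sub_le N l)
    have hq2 := h.qN_le_two (Nat.sub_le N l)
    have hR0 := h.ratioLimit_pos
    have hR2 := (h.ratioLimit_mem).2
    rw [abs_le]; constructor <;> linarith
  -- iterating the improvement step
  have Hiter : ∀ (J : ℕ) {τ : ℝ}, 0 < τ → ∀ k : ℕ, ∀ l : ℕ, ∀ᶠ N in atTop,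
      |qN P σ N (N - l) - ratioLimit P σ| ≤
        (4 * contractionC P σ) ^ k * 4 +
          4 * ((J + 1) * 2 ^ J * τ + 2 * geomTail P σ J) / (1 - 4 * contractionC P σ) := by
    intro J τ hτ k
    have hb : 0 ≤ 4 * ((J + 1) * 2 ^ J * τ + 2 * geomTail P σ J) / (1 - 4 * contractionC P σ) := by
      have := h.geomTail_nonneg J
      exact div_nonneg (by positivity) (by linarith)
    induction k with
    | zero =>
        intro l
        refine (H0 l).mono fun N hN => hN.trans ?_
        rw [pow_zero, one_mul]
        linarith
    | succ k ih =>
        intro l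
        have hηk : 0 ≤ (4 * contractionC P σ) ^ k * 4 +
            4 * ((J + 1) * 2 ^ J * τ + 2 * geomTail P σ J) / (1 - 4 * contractionC P σ) := by
          positivity
        refine (h.eventually_abs_qN_sub_le_step hηk ih J hτ l).mono fun N hN => ?_
        refine hN.trans (le_of_eq ?_)
        have h1A : (1 - 4 * contractionC P σ) ≠ 0 := by linarith
        field_simp
        ring
  -- conclusion
  rw [Metric.tendsto_nhds]
  intro ε hε
  have hθ0 := h.geomRatio_nonneg
  -- choose `J` with a small tail
  obtain ⟨δ₀, hδ₀⟩ : ∃ δ₀ : ℝ, δ₀ = ε * (1 - 4 * contractionC P σ) / 24 := ⟨_, rfl⟩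
  have hδ₀pos : 0 < δ₀ := by rw [hδ₀]; exact div_pos (mul_pos hε (by linarith)) (by norm_num)
  have htail : Tendsto (fun J => geomTail P σ J) atTop (𝓝 0) := by
    have h := (tendsto_pow_atTop_nhds_zero_of_lt_one hθ0 h.geomRatio_lt_one).comp (tendsto_add_atTop_nat 1)
    have h' := h.mul_const (Real.exp 1 / (1 - geomRatio P σ))
    rw [zero_mul] at h'
    refine h'.congr fun J => ?_
    simp only [Function.comp_apply, geomTail]; ring
  obtain ⟨J, hJ⟩ := ((Metric.tendsto_nhds.mp htail) δ₀ hδ₀pos).exists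
  rw [Real.dist_eq, sub_zero, abs_of_nonneg (h.geomTail_nonneg J)] at hJ
  -- choose `τ`
  obtain ⟨τ, hτ_def⟩ : ∃ τ : ℝ, τ = δ₀ / ((J + 1) * 2 ^ J) := ⟨_, rfl⟩
  have hJpos : (0 : ℝ) < (J + 1) * 2 ^ J := by positivity
  have hτpos : 0 < τ := by rw [hτ_def]; exact div_pos hδ₀pos hJpos
  have hτeq : (J + 1) * 2 ^ J * τ = δ₀ := by rw [hτ_def]; field_simp
  -- choose `k`
  obtain ⟨k, hk⟩ := exists_pow_lt_of_lt_one (show 0 < ε / 8 by positivity) hA1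
  filter_upwards [Hiter J hτpos k l] with N hN
  rw [Real.dist_eq]
  refine lt_of_le_of_lt hN ?_
  rw [hτeq]
  have h1 : (4 * contractionC P σ) ^ k * 4 < ε / 2 := by
    rw [lt_div_iff₀ (by norm_num : (0 : ℝ) < 8)] at hk
    linarith
  have h2 : 4 * (δ₀ + 2 * geomTail P σ J) / (1 - 4 * contractionC P σ) ≤ ε / 2 := by
    rw [div_le_iff₀ (by linarith)]
    have : 4 * (δ₀ + 2 * geomTail P σ J) ≤ 12 * δ₀ := by linarith
    refine this.trans (le_of_eq ?_)
    rw [hδ₀]; ring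
  linarith

/-- **Convergence of the products of ratios**: `r_N(N+1-s, j) → R(σ)ʲ` for all fixed `s, j`.
[folklore] -/
theorem tendsto_rN (s j : ℕ) :
    Tendsto (fun N => rN P σ N (N + 1 - s) j) atTop (𝓝 (ratioLimit P σ ^ j)) := by
  have hlam1 := h.ovDensity_lt_one
  induction j with
  | zero =>
      simp_rw [pow_zero]
      refine tendsto_const_nhds.congr' (Eventually.of_forall fun N => ?_)
      exact (rN_zero h.σ_pos.le h.σ_lt_half hlam1 (Nat.sub_le (N + 1) s)).symm
  | succ j ih =>
      have hmul := ih.mul (h.tendsto_qN_sub (s + j))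
      rw [← pow_succ] at hmul
      refine hmul.congr' ?_
      filter_upwards [eventually_ge_atTop (s + j)] with N hN
      rw [rN_succ h.σ_pos.le h.σ_lt_half hlam1 (Nat.sub_le (N + 1) s) (by omega)]
      congr 2
      omega

end SmallDensity

end

end Literature.MathematicalPhysics.KineticTheory
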